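import Literature.MathematicalPhysics.QuantumFieldTheory.ConformalBootstrap3D.PointKernelK34L505Data
import Literature.MathematicalPhysics.QuantumFieldTheory.ConformalBootstrap3D.PointKernelK34L505Segs

/-!
# K34L505 certificate, kernel block file H6: head segments (monotone coefficient rule; block checker `PCert.hBlockOK` of `PointKernel`, soundness `PCert.hBlockOK_sound`), segments `132 ≤ i < 160`

`decide` by kernel reduction (no `native_decide`, no extra axioms) on the literal data of
`PointKernelK34L505Data`, on the certificate itself (full `s`-width) or on its piece certificates
`pcP_i = certK34L505.withS σ_i σ_(i+1) …` (the cell numbers on an `s`-piece; assembled by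
`CellFactS_of_pieces`).  Estimated kernel time 229 s (5 theorems).
-/

set_option maxRecDepth 100000
set_option maxHeartbeats 0

namespace Literature.MathematicalPhysics.QuantumFieldTheory.ConformalBootstrap3D.PointKernelK34L505

open Literature.MathematicalPhysics.QuantumFieldTheory.ConformalBootstrap3D.PointKernel

/-- segments `[132, 134)` of `hsegsK34L505` pass the kernel evaluator (≈47 s of kernel work). [folklore] -/
theorem hBlock_132 : certK34L505.hBlockOK hsegsK34L505 132 134 JHK34L505 = true := by
  decide +kernel

/-- segments `[134, 141)` of `hsegsK34L505` pass the kernel evaluator (≈45 s of kernel work). [folklore] -/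
theorem hBlock_134 : certK34L505.hBlockOK hsegsK34L505 134 141 JHK34L505 = true := by
  decide +kernel

/-- segments `[141, 149)` of `hsegsK34L505` pass the kernel evaluator (≈5 s of kernel work). [folklore] -/
theorem hBlock_141 : certK34L505.hBlockOK hsegsK34L505 141 149 JHK34L505 = true := by
  decide +kernel

/-- segment `[158, 159)` of `hsegsK34L505` passes the kernel evaluator (≈41 s of kernel work). [folklore] -/
theorem hBlock_158 : certK34L505.hBlockOK hsegsK34L505 158 159 JHK34L505 = true := by
  decide +kernel

/-- segment `[159, 160)` of `hsegsK34L505` passes the kernel evaluator (≈32 s of kernel work). [folklore] -/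
theorem hBlock_159 : certK34L505.hBlockOK hsegsK34L505 159 160 JHK34L505 = true := by
  decide +kernel

end Literature.MathematicalPhysics.QuantumFieldTheory.ConformalBootstrap3D.PointKernelK34L505
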